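import Literature.AlgebraicGeometry.Motives.AbelianVarietyTranslation
import Literature.AlgebraicGeometry.Motives.GrpObjOfAlgPoints
import Literature.AlgebraicGeometry.Motives.GeometricallyIntegralAlgClosed
import Literature.AlgebraicGeometry.Motives.AbelianVarietyImageSimpleProofs
import Mathlib.AlgebraicGeometry.IdealSheaf.Functorial
import HarnessLib

/-!
# The identity component of the kernel; non-zero homomorphisms between simple abelian varieties
# are isogenies (Mumford, *Abelian Varieties*, §19, Cor. 2 of Thm. 1)

Over an algebraically closed field `K`, let `g : X ↠ Y` be a surjective homomorphism of abelian
varieties with `0 < dim Y < dim X`. Then `X` is not simple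
(`AbelianVariety.not_isSimple_of_surjective_of_dim_lt`): the kernel `g⁻¹(e)` has dimension
`dim X - dim Y ≥ 1` (`dim_eq_dim_add_topologicalKrullDim_ker`, `Motives/AbelianVarietyKernelDimension`),
and an irreducible component of `(g⁻¹(e))_red` through the origin is an abelian subvariety of `X` of
dimension strictly between `0` and `dim X` — this is the abelian subvariety "(identity component of
the kernel)" of Mumford §19 (proof of Thm. 1 and Cor. 2, p. 173–174) and Milne 1986, §12 (proof of
Prop. 12.1: "the connected component of the kernel … is an abelian subvariety"). Combined with the
image factorisation (`Motives/AbelianVarietyImageSimpleProofs.surjective_of_isSimple`: a non-zero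
homomorphism to a simple abelian variety is surjective) this gives **Mumford §19, Cor. 2 of Thm. 1**
over `K = K̄`: a non-zero homomorphism between simple abelian varieties is an isogeny
(`AbelianVariety.isIsogeny_of_isSimple_of_ne_zero`), i.e. the hypothesis `hsimple` of
`AbelianVariety.module_finite_hom_of_theoremOfCube_of_algebraicClosure`
(`DiophantineGeometry/AVIsogenyTateHomCubeProofs`) and of the semisimplicity statements of
`Motives/AbelianVarietyEndAlgebraSemisimpleProofs`.

## The construction (all proved; no named facts)

* `exists_maximal_isPreirreducible_subset` — Zorn: an irreducible subset `D ⊆ S` of a topological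
  space lies in a maximal irreducible subset of `S` (Mathlib `exists_preirreducible` is `S = univ`).
* `Scheme.Hom.ker_eq_vanishingIdeal_closure_range`, `Scheme.Hom.ker_le_ker_of_range_subset_closure` —
  for a morphism `m : W → S` from a *reduced* scheme, `ker m = 𝓘(closure (im m))` (Mathlib
  `map_vanishingIdeal`); hence `m` factors through a reduced closed subscheme `Z ↪ S` as soon as
  `im m ⊆ closure (im Z)` (Mathlib `IsClosedImmersion.lift`). This is how all structure maps below are
  built, and why `K` is taken algebraically closed: products of integral `K`-schemes are then integral
  (`geometricallyIntegral_of_isAlgClosed`, `Motives/GeometricallyIntegralAlgClosed`), so `X_C × X_C`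
  is reduced.
* `AbelianVariety.redSub C …` — for a closed irreducible `C ⊆ X` containing the origin and stable in
  the sense `δ(X_C × X_C) ⊆ C`, `δ(x, y) = x y⁻¹` (`divMor`), the reduced closed subscheme `X_C`
  (Mathlib `Scheme.IdealSheafData.vanishingIdeal C |>.subscheme`) with unit, `y⁻¹ = δ(e, y)` and
  `x y = δ(x, δ(e, y))` lifted from `X`, is an abelian variety (group axioms checked on `K`-points in
  `X(K)`, `GrpObj.ofAlgPointsOfInjective`) with a closed-immersion homomorphism `redSubHom : X_C → X`;
  `0 < dim X_C` iff `C` has two points, `dim X_C < dim X` iff `C ≠ X` (`dim_redSub_pos`, `dim_redSub_lt`).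
* `AbelianVariety.exists_maximal_irreducible_kerSet` — for `g : X ↠ Y` with `0 < dim Y < dim X`:
  the kernel contains points `x₁ ⤳ x₀`, `x₁ ≠ x₀` (dimension formula); translating `closure {x₁}` by
  the inverse of one of its closed points (rational, `K = K̄`: `AbelianVariety.pointOfClosed`;
  translations by kernel points preserve `g⁻¹(e)`, `translation_comp_eq_self`) gives an irreducible
  `D ∋ e` inside `g⁻¹(e)` with two points; a maximal irreducible `C ⊇ D` inside `g⁻¹(e)` is closed,
  `≠ X` (else `Y = {e}`, `dim Y = 0`), and stable: `δ(X_C × X_C)` is irreducible, contains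
  `C = δ(C × e)` and lies in `g⁻¹(e)` because `g` kills `X_C` (`redSubι_comp_eq_one`, the
  factorisation of `X_C → X → Y` through the reduced point `e : Spec K ↪ Y`), so its closure is `C`
  (`range_divMor_subset_of_maximal`).

Mathlib searched (pin): `Scheme.IdealSheafData.vanishingIdeal`/`subscheme`/`subschemeι`,
`ker_subschemeι`, `map_vanishingIdeal`, `map_bot`, `vanishingIdeal_top`, `Scheme.nilradical_eq_bot`,
`vanishingIdeal_antimono`, `IsClosedImmersion.lift`/`lift_fac`, `IsClosed.exists_closed_singleton`,
`Order.one_le_krullDim_iff`, `Order.krullDim_nonpos_of_subsingleton`, `specializationOrder`,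
`MonObj.mul_comp`/`comp_mul`/`comp_one`, `GrpObj.inv_comp`/`comp_inv`, `Hom.one_def`/`mul_def`
(all used). Mathlib has no abelian (sub)varieties and no identity components of group schemes.
In this tree (used): `AbelianVariety.translation`, `pointOfClosed`, `eq_of_base_eq_origin`,
`Hom.range_kerι`, `dim_eq_dim_add_topologicalKrullDim_ker`, `GrpObj.ofAlgPointsOfInjective`,
`geometricallyIntegral_of_isAlgClosed`, `surjective_of_isSimple`,
`dim_lt_of_isClosedImmersion_of_not_surjective`, `Literature.Topology.topologicalKrullDim_eq_krullDim`.

## References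

* D. Mumford, *Abelian Varieties*, TIFR Studies in Mathematics 5, OUP (1970): §19, Thm. 1 and its
  proof (p. 173), Cor. 2 of Thm. 1 (p. 174). [MumfordAV1970]
* J. S. Milne, *Abelian Varieties*, in: Cornell–Silverman (eds.), *Arithmetic Geometry*, Springer
  (1986): §12, Prop. 12.1 and its proof; §8 (isogenies). [Milne1986AbelianVarieties]
* U. Görtz, T. Wedhorn, *Algebraic Geometry I*, 2nd ed. (2020), Prop. 5.51 / Cor. 5.54 (geometric
  integrality over algebraically closed fields). [GortzWedhorn2020]
-/

universe u

open CategoryTheory CategoryTheory.Limits AlgebraicGeometry MonoidalCategory CartesianMonoidalCategory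
open TopologicalSpace Topology

noncomputable section

namespace Literature.AlgebraicGeometry.Motives

open scoped MonObj
open Scheme.IdealSheafData

/-! ### Generalities: maximal irreducible subsets, kernels of morphisms from reduced schemes -/

/-- Every (pre)irreducible subset `D` of a subset `S` of a topological space is contained in a
maximal preirreducible subset of `S` (Zorn; Mathlib `exists_preirreducible` is the case `S = univ`).
[folklore] -/
theorem exists_maximal_isPreirreducible_subset {α : Type*} [TopologicalSpace α] {S D : Set α}
    (hD : IsPreirreducible D) (hDS : D ⊆ S) :
    ∃ C : Set α, IsPreirreducible C ∧ D ⊆ C ∧ C ⊆ S ∧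
      ∀ Z : Set α, IsPreirreducible Z → C ⊆ Z → Z ⊆ S → Z = C := by
  obtain ⟨m, hDm, hm⟩ := zorn_subset_nonempty {t : Set α | IsPreirreducible t ∧ t ⊆ S}
    (fun c hc hcc _ => ⟨⋃₀ c,
      ⟨fun u v hu hv ⟨y, hy, hyu⟩ ⟨x, hx, hxv⟩ => by
        obtain ⟨p, hpc, hyp⟩ := Set.mem_sUnion.1 hy
        obtain ⟨q, hqc, hxq⟩ := Set.mem_sUnion.1 hx
        rcases hcc.total hpc hqc with hpq | hqp
        · obtain ⟨z, hzq, hzuv⟩ := (hc hqc).1 u v hu hv ⟨y, hpq hyp, hyu⟩ ⟨x, hxq, hxv⟩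
          exact ⟨z, Set.mem_sUnion_of_mem hzq hqc, hzuv⟩
        · obtain ⟨z, hzp, hzuv⟩ := (hc hpc).1 u v hu hv ⟨y, hyp, hyu⟩ ⟨x, hqp hxq, hxv⟩
          exact ⟨z, Set.mem_sUnion_of_mem hzp hpc, hzuv⟩,
        Set.sUnion_subset fun t ht => (hc ht).2⟩,
      fun _ hxc => Set.subset_sUnion_of_mem hxc⟩)
    D ⟨hD, hDS⟩
  exact ⟨m, hm.prop.1, hDm, hm.prop.2, fun Z hZ hmZ hZS => (hm.eq_of_subset ⟨hZ, hZS⟩ hmZ).symm⟩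

/-- The kernel (ideal sheaf) of a morphism `f : V → S` from a reduced scheme is the vanishing ideal
of the closure of its image (Mathlib `map_vanishingIdeal` with `⊥ = nilradical = 𝓘(V)`). This is
`Literature.AlgebraicGeometry.Resolution.ker_eq_vanishingIdeal_closure_range` of
`Resolution/AlterationsStrictTransformModel` (de Jong's alterations), re-derived in three lines to keep
that development out of the imports of the abelian-variety files. [folklore] -/
theorem Scheme.Hom.ker_eq_vanishingIdeal_closure_range {V S : Scheme.{u}} [IsReduced V] (f : V ⟶ S) :
    f.ker = vanishingIdeal (Closeds.closure (Set.range f)) := by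
  rw [← map_bot, ← Scheme.nilradical_eq_bot, ← vanishingIdeal_top, map_vanishingIdeal,
    Closeds.coe_top, Set.image_univ]

/-- **Factorisation through a reduced closed subscheme is set-theoretic.** For morphisms
`i : Z → S`, `m : W → S` with `Z`, `W` reduced, if the image of `m` lies in the closure of the
image of `i` then `ker i ≤ ker m`; so when `i` is a closed immersion, `m` factors through `i`
(Mathlib `IsClosedImmersion.lift`). [folklore] -/
theorem Scheme.Hom.ker_le_ker_of_range_subset_closure {S Z W : Scheme.{u}} [IsReduced Z] [IsReduced W]
    (i : Z ⟶ S) (m : W ⟶ S) (h : Set.range m ⊆ closure (Set.range i)) : i.ker ≤ m.ker := by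
  rw [Scheme.Hom.ker_eq_vanishingIdeal_closure_range i, Scheme.Hom.ker_eq_vanishingIdeal_closure_range m]
  refine vanishingIdeal_antimono (Closeds.closure_le.2 ?_)
  exact h

/-- The reduced closed subscheme on an irreducible closed subset is integral (reduced: its affine
pieces are spectra of quotients by radical ideals; irreducible: its space is `Z`). This is
`Literature.AlgebraicGeometry.Resolution.isIntegral_subscheme_vanishingIdeal`, re-derived to keep the
resolution-of-singularities development out of the imports. [folklore] -/
theorem isIntegral_subscheme_vanishingIdeal_of_isIrreducible {S : Scheme.{u}} (Z : Closeds S)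
    (hZ : IsIrreducible (Z : Set S)) : IsIntegral (vanishingIdeal Z).subscheme := by
  haveI : IrreducibleSpace (vanishingIdeal Z).subscheme := by
    have e : ((vanishingIdeal Z).support : Set S) = Z := coe_support_vanishingIdeal Z
    have : IsIrreducible ((vanishingIdeal Z).support : Set S) := by rw [e]; exact hZ
    exact Subtype.irreducibleSpace this
  haveI : IsReduced (vanishingIdeal Z).subscheme := by
    haveI : ∀ U, IsReduced ((vanishingIdeal Z).subschemeCover.openCover.X U) := by
      intro (U : S.affineOpens)
      change IsReduced (Spec (.of (Γ(S, (U : S.Opens)) ⧸ (vanishingIdeal Z).ideal U)))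
      haveI : _root_.IsReduced (Γ(S, (U : S.Opens)) ⧸ (vanishingIdeal Z).ideal U) := by
        rw [← Ideal.isRadical_iff_quotient_reduced, vanishingIdeal_ideal]
        exact PrimeSpectrum.isRadical_vanishingIdeal _
      infer_instance
    exact IsReduced.of_openCover _ (vanishingIdeal Z).subschemeCover.openCover
  exact isIntegral_of_irreducibleSpace_of_isReduced _

/-- The range of the inclusion of the reduced closed subscheme on `Z` is `Z`. [folklore] -/
theorem range_subschemeι_vanishingIdeal_eq {S : Scheme.{u}} (Z : Closeds S) :
    Set.range (vanishingIdeal Z).subschemeι = (Z : Set S) := by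
  rw [range_subschemeι, coe_support_vanishingIdeal]

namespace AbelianVariety

variable {K : Type u} [Field K]

/-! ### The difference morphism `(x, y) ↦ x - y` and the unit point -/

/-- The difference morphism `δ : X ×_K X → X`, `(x, y) ↦ x · y⁻¹`. [folklore] -/
def divMor (X : AbelianVariety K) : X.X ⊗ X.X ⟶ X.X :=
  CartesianMonoidalCategory.fst X.X X.X * (CartesianMonoidalCategory.snd X.X X.X)⁻¹

/-- The underlying morphism of the unit `1 : T → X` of `Hom_K(T, X)` has image the origin.
[folklore] -/
theorem range_one_left_subset (X : AbelianVariety K) (T : SchemeOver K) :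
    Set.range (1 : T ⟶ X.X).left ⊆ {origin X} := by
  rw [one_left]
  rintro _ ⟨t, rfl⟩
  rw [Scheme.Hom.comp_apply, ← range_unitPt]
  exact ⟨_, rfl⟩

/-! ### Reduced closed subgroup schemes: the abelian subvariety on a stable irreducible closed subset -/

section SubVariety

variable {X : AbelianVariety K} (C : Closeds X.X.left)

/-- The reduced closed subscheme of `X` on the closed subset `C`, as a `K`-scheme. [folklore] -/
def redSubOver : SchemeOver K := Over.mk ((vanishingIdeal C).subschemeι ≫ X.X.hom)

/-- The inclusion of the reduced closed subscheme on `C`, as a `K`-morphism. [folklore] -/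
def redSubι : redSubOver C ⟶ X.X := Over.homMk (vanishingIdeal C).subschemeι rfl

/-- The underlying morphism of `X_C ↪ X` is the subscheme inclusion. [folklore] -/
@[simp]
theorem redSubι_left : (redSubι C).left = (vanishingIdeal C).subschemeι := rfl

/-- The underlying scheme of `X_C` is the reduced closed subscheme on `C`. [folklore] -/
theorem redSubOver_left : (redSubOver C).left = (vanishingIdeal C).subscheme := rfl

/-- The structure map of `X_C` is `X_C ↪ X → Spec K`. [folklore] -/
theorem redSubOver_hom : (redSubOver C).hom = (vanishingIdeal C).subschemeι ≫ X.X.hom := rfl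

/-- `X_C ↪ X` is a closed immersion. [folklore] -/
instance isClosedImmersion_redSubι_left : IsClosedImmersion (redSubι C).left :=
  (inferInstance : IsClosedImmersion (vanishingIdeal C).subschemeι)

/-- `X_C ↪ X` is a monomorphism of `K`-schemes. [folklore] -/
instance mono_redSubι : Mono (redSubι C) :=
  (Over.forget _).mono_of_mono_map (by change Mono (vanishingIdeal C).subschemeι; infer_instance)

/-- `X_C` is reduced (its affine pieces are spectra of quotients by radical ideals). [folklore] -/
instance isReduced_redSubOver_left : IsReduced (redSubOver C).left := by
  change IsReduced (vanishingIdeal C).subscheme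
  haveI : ∀ U, IsReduced ((vanishingIdeal C).subschemeCover.openCover.X U) := by
    intro (U : X.X.left.affineOpens)
    change IsReduced (Spec (.of (Γ(X.X.left, (U : X.X.left.Opens)) ⧸ (vanishingIdeal C).ideal U)))
    haveI : _root_.IsReduced (Γ(X.X.left, (U : X.X.left.Opens)) ⧸ (vanishingIdeal C).ideal U) := by
      rw [← Ideal.isRadical_iff_quotient_reduced, vanishingIdeal_ideal]
      exact PrimeSpectrum.isRadical_vanishingIdeal _
    infer_instance
  exact IsReduced.of_openCover _ (vanishingIdeal C).subschemeCover.openCover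

/-- `X_C → Spec K` is locally of finite type. [folklore] -/
instance locallyOfFiniteType_redSubOver_hom : LocallyOfFiniteType (redSubOver C).hom := by
  change LocallyOfFiniteType ((vanishingIdeal C).subschemeι ≫ X.X.hom); infer_instance

/-- `X_C → Spec K` is separated. [folklore] -/
instance isSeparated_redSubOver_hom : IsSeparated (redSubOver C).hom := by
  change IsSeparated ((vanishingIdeal C).subschemeι ≫ X.X.hom); infer_instance

/-- `X_C → Spec K` is proper (closed in the proper `X`). [folklore] -/
instance isProper_redSubOver_hom : IsProper (redSubOver C).hom := by
  change IsProper ((vanishingIdeal C).subschemeι ≫ X.X.hom); infer_instance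

/-- The range of the inclusion is `C`. [folklore] -/
theorem range_redSubι_left : Set.range (redSubι C).left = (C : Set X.X.left) :=
  range_subschemeι_vanishingIdeal_eq C

variable (hC : IsIrreducible (C : Set X.X.left))

include hC in
/-- `X_C` is integral for `C` irreducible. [folklore] -/
theorem isIntegral_redSubOver_left : IsIntegral (redSubOver C).left :=
  isIntegral_subscheme_vanishingIdeal_of_isIrreducible C hC

include hC in
/-- Over an algebraically closed field the reduced closed subscheme on an irreducible closed subset
is geometrically integral (`geometricallyIntegral_of_isAlgClosed`). [folklore] -/
theorem geometricallyIntegral_redSubOver_hom [IsAlgClosed K] :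
    GeometricallyIntegral (redSubOver C).hom := by
  haveI := isIntegral_redSubOver_left C hC
  exact geometricallyIntegral_of_isAlgClosed _

/-- **Morphisms from reduced schemes into `X` with image in `C` factor through the reduced
subscheme on `C`.** [folklore] -/
theorem ker_redSubι_le_ker {W : Scheme.{u}} [IsReduced W] (m : W ⟶ X.X.left)
    (hm : Set.range m ⊆ C) : (redSubι C).left.ker ≤ m.ker :=
  Scheme.Hom.ker_le_ker_of_range_subset_closure _ _ (by
    rw [range_redSubι_left, C.isClosed.closure_eq]; exact hm)

/-! #### The unit -/

variable (h1 : origin X ∈ C)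

/-- The unit `Spec K → X_C` (the origin lies on `C`). [folklore] -/
def redSubOneLeft : Spec (.of K) ⟶ (redSubOver C).left :=
  IsClosedImmersion.lift (redSubι C).left (η[X.X]).left
    (ker_redSubι_le_ker C _ (by
      intro x hx
      have hx' : x ∈ Set.range (unitPt X) := hx
      rw [range_unitPt, Set.mem_singleton_iff] at hx'
      rw [hx']
      exact h1))

/-- The unit of `X_C` followed by `X_C ↪ X` is the unit of `X` (on schemes). [folklore] -/
@[reassoc (attr := simp)]
theorem redSubOneLeft_ι : redSubOneLeft C h1 ≫ (redSubι C).left = (η[X.X]).left :=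
  IsClosedImmersion.lift_fac _ _ _

/-- The unit of `X_C`. [folklore] -/
def redSubOne : 𝟙_ (SchemeOver K) ⟶ redSubOver C :=
  Over.homMk (redSubOneLeft C h1) (by
    change redSubOneLeft C h1 ≫ (redSubι C).left ≫ X.X.hom = _
    rw [redSubOneLeft_ι_assoc]; exact Over.w _)

/-- The unit of `X_C` followed by `X_C ↪ X` is the unit of `X`. [folklore] -/
@[reassoc (attr := simp)]
theorem redSubOne_ι : redSubOne C h1 ≫ redSubι C = η[X.X] := by
  ext1; exact redSubOneLeft_ι C h1

/-! #### The difference, inverse and multiplication -/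

variable [IsAlgClosed K]
  (hδ : Set.range ((redSubι C ⊗ₘ redSubι C) ≫ divMor X).left ⊆ C)

include hC in
/-- The difference `X_C × X_C → X_C`, the lift of `(x, y) ↦ x y⁻¹`. [folklore] -/
def redSubDivLeft : (redSubOver C ⊗ redSubOver C).left ⟶ (redSubOver C).left :=
  haveI := geometricallyIntegral_redSubOver_hom C hC
  haveI : IsReduced (redSubOver C ⊗ redSubOver C).left := SchemeOver.isReduced_left _
  IsClosedImmersion.lift (redSubι C).left ((redSubι C ⊗ₘ redSubι C) ≫ divMor X).left
    (ker_redSubι_le_ker C _ hδ)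

/-- The difference of `X_C` followed by `X_C ↪ X` is the difference of `X` (on schemes). [folklore] -/
@[reassoc (attr := simp)]
theorem redSubDivLeft_ι :
    redSubDivLeft C hC hδ ≫ (redSubι C).left = ((redSubι C ⊗ₘ redSubι C) ≫ divMor X).left :=
  IsClosedImmersion.lift_fac _ _ _

/-- The difference morphism of `X_C`. [folklore] -/
def redSubDiv : redSubOver C ⊗ redSubOver C ⟶ redSubOver C :=
  Over.homMk (redSubDivLeft C hC hδ) (by
    change redSubDivLeft C hC hδ ≫ (redSubι C).left ≫ X.X.hom = _
    rw [redSubDivLeft_ι_assoc]; exact Over.w _)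

/-- The difference of `X_C` followed by `X_C ↪ X` is the difference of `X`. [folklore] -/
@[reassoc (attr := simp)]
theorem redSubDiv_ι : redSubDiv C hC hδ ≫ redSubι C = (redSubι C ⊗ₘ redSubι C) ≫ divMor X := by
  ext1; exact redSubDivLeft_ι C hC hδ

/-- The inverse of `X_C`: `y ↦ δ(e, y)`. [folklore] -/
def redSubInv : redSubOver C ⟶ redSubOver C :=
  CartesianMonoidalCategory.lift (CartesianMonoidalCategory.toUnit _ ≫ redSubOne C h1) (𝟙 _) ≫
    redSubDiv C hC hδ

/-- The inverse of `X_C` followed by `X_C ↪ X` is the inverse of `X_C ↪ X` in `Hom_K(X_C, X)`. [folklore] -/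
@[reassoc (attr := simp)]
theorem redSubInv_ι : redSubInv C hC h1 hδ ≫ redSubι C = (redSubι C)⁻¹ := by
  unfold redSubInv
  rw [Category.assoc, redSubDiv_ι, CartesianMonoidalCategory.lift_map_assoc, Category.assoc,
    redSubOne_ι, Category.id_comp]
  unfold divMor
  rw [MonObj.comp_mul, GrpObj.comp_inv, CartesianMonoidalCategory.lift_fst,
    CartesianMonoidalCategory.lift_snd, ← Hom.one_def, one_mul]

/-- The multiplication of `X_C`: `(x, y) ↦ δ(x, δ(e, y))`. [folklore] -/
def redSubMul : redSubOver C ⊗ redSubOver C ⟶ redSubOver C :=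
  CartesianMonoidalCategory.lift (CartesianMonoidalCategory.fst _ _)
    (CartesianMonoidalCategory.snd _ _ ≫ redSubInv C hC h1 hδ) ≫ redSubDiv C hC hδ

/-- The multiplication of `X_C` followed by `X_C ↪ X` is the product of the two projections in
`Hom_K(X_C × X_C, X)`. [folklore] -/
theorem redSubMul_ι' :
    redSubMul C hC h1 hδ ≫ redSubι C =
      (CartesianMonoidalCategory.fst _ _ ≫ redSubι C) * (CartesianMonoidalCategory.snd _ _ ≫ redSubι C) := by
  unfold redSubMul
  rw [Category.assoc, redSubDiv_ι, CartesianMonoidalCategory.lift_map_assoc, Category.assoc, redSubInv_ι]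
  unfold divMor
  rw [MonObj.comp_mul, CartesianMonoidalCategory.lift_fst, GrpObj.comp_inv, GrpObj.comp_inv,
    CartesianMonoidalCategory.lift_snd, inv_inv]

/-- `X_C ↪ X` respects multiplication. [folklore] -/
@[reassoc]
theorem redSubMul_ι :
    redSubMul C hC h1 hδ ≫ redSubι C = (redSubι C ⊗ₘ redSubι C) ≫ μ[X.X] := by
  rw [redSubMul_ι', Hom.mul_def, CartesianMonoidalCategory.lift_fst_comp_snd_comp]

/-- **The group-scheme structure on `X_C`**, detected on `K`-points inside `X(K)`. [folklore] -/
@[implicit_reducible]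
def redSubGrpObj : GrpObj (redSubOver C) :=
  haveI := geometricallyIntegral_redSubOver_hom C hC
  GrpObj.ofAlgPointsOfInjective (Ω := K) (mul := redSubMul C hC h1 hδ) (one := redSubOne C h1)
    (inv := redSubInv C hC h1 hδ) (G := Additive (AlgPoints X.X K))
    (fun P => Additive.ofMul (P ≫ redSubι C))
    (fun P Q h => (cancel_mono (redSubι C)).1 (Additive.ofMul.injective h))
    (fun P Q => by
      rw [← ofMul_mul]
      congr 1
      rw [Category.assoc, redSubMul_ι', MonObj.comp_mul, CartesianMonoidalCategory.lift_fst_assoc,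
        CartesianMonoidalCategory.lift_snd_assoc])
    (by rw [← ofMul_one]; congr 1; rw [Category.assoc, redSubOne_ι, ← Hom.one_def])
    (fun P => by
      rw [← ofMul_inv]; congr 1; rw [Category.assoc, redSubInv_ι, GrpObj.comp_inv])

/-- **The abelian subvariety of `X` on `C`.** [folklore] -/
def redSub : AbelianVariety K where
  X := redSubOver C
  grpObj := redSubGrpObj C hC h1 hδ
  isProper := isProper_redSubOver_hom C
  geometricallyIntegral := geometricallyIntegral_redSubOver_hom C hC

/-- The inclusion `X_C ↪ X`, a homomorphism and a closed immersion. [folklore] -/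
def redSubHom : redSub C hC h1 hδ ⟶ X :=
  InducedCategory.homMk (Grp.homMk'' (A := (redSub C hC h1 hδ).toGrp) (B := X.toGrp) (redSubι C)
    (redSubOne_ι C h1) (redSubMul_ι C hC h1 hδ))

/-- On schemes, `redSubHom` is the subscheme inclusion. [folklore] -/
theorem toSchemeHom_redSubHom :
    Hom.toSchemeHom (redSubHom C hC h1 hδ) = (vanishingIdeal C).subschemeι := rfl

/-- `redSubHom : X_C → X` is a closed immersion. [folklore] -/
instance isClosedImmersion_toSchemeHom_redSubHom :
    IsClosedImmersion (Hom.toSchemeHom (redSubHom C hC h1 hδ)) :=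
  (inferInstance : IsClosedImmersion (vanishingIdeal C).subschemeι)

/-- `dim X_C < dim X` when `C ≠ X`. [folklore] -/
theorem dim_redSub_lt (hCX : (C : Set X.X.left) ≠ Set.univ) : (redSub C hC h1 hδ).dim < X.dim :=
  dim_lt_of_isClosedImmersion_of_not_surjective (redSubHom C hC h1 hδ) (fun hs => hCX (by
    rw [← range_subschemeι_vanishingIdeal_eq C]; exact hs.range_eq))

/-- `0 < dim X_C` when `C` has at least two points. [folklore] -/
theorem dim_redSub_pos (h2 : (C : Set X.X.left).Nontrivial) : 0 < (redSub C hC h1 hδ).dim := by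
  obtain ⟨a, ha, b, hb, hab⟩ := h2
  let B := redSub C hC h1 hδ
  haveI : IsIntegral B.X.left := isIntegral_redSubOver_left C hC
  -- preimages of `a ≠ b` in `X_C`
  have hr : (C : Set X.X.left) = Set.range (vanishingIdeal C).subschemeι :=
    (range_subschemeι_vanishingIdeal_eq C).symm
  obtain ⟨a', rfl⟩ : a ∈ Set.range (vanishingIdeal C).subschemeι := hr ▸ ha
  obtain ⟨b', rfl⟩ : b ∈ Set.range (vanishingIdeal C).subschemeι := hr ▸ hb
  have hab' : a' ≠ b' := fun h => hab (h ▸ rfl)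
  -- one of them is not the generic point
  let ξ := genericPoint B.X.left
  have key : ∃ y : B.X.left, y ≠ ξ := by
    by_cases h : a' = ξ
    · exact ⟨b', fun hb' => hab' (h.trans hb'.symm)⟩
    · exact ⟨a', h⟩
  obtain ⟨y, hy⟩ := key
  letI : PartialOrder B.X.left := specializationOrder B.X.left
  have hlt : y < ξ := lt_of_le_of_ne (genericPoint_specializes y) hy
  have h1le : (1 : WithBot ℕ∞) ≤ topologicalKrullDim B.X.left := by
    rw [Literature.Topology.topologicalKrullDim_eq_krullDim]
    exact Order.one_le_krullDim_iff.2 ⟨y, ξ, hlt⟩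
  rw [topologicalKrullDim_left] at h1le
  exact_mod_cast h1le

end SubVariety

/-! ### The kernel of a homomorphism: an irreducible component through the origin -/

section KernelComponent

variable {X Y : AbelianVariety K} (g : X ⟶ Y)

/-- The kernel of `g` as a closed subset of `X`: the fibre `g⁻¹(e)`. [folklore] -/
def kerSet : Set X.X.left := (Hom.toSchemeHom g) ⁻¹' {origin Y}

/-- The kernel set is the image of the scheme-theoretic kernel `Ker g → X`. [folklore] -/
theorem kerSet_eq_range_kerι : kerSet g = Set.range (Hom.kerι g) := (Hom.range_kerι g).symm

/-- Membership in the kernel set. [folklore] -/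
theorem mem_kerSet_iff {x : X.X.left} : x ∈ kerSet g ↔ (Hom.toSchemeHom g) x = origin Y := Iff.rfl

/-- The kernel set is closed. [folklore] -/
theorem isClosed_kerSet : IsClosed (kerSet g) := by
  haveI : IsClosedImmersion (Hom.kerι g) := MorphismProperty.pullback_fst _ _ inferInstance
  rw [kerSet_eq_range_kerι]
  exact (Hom.kerι g).isClosedEmbedding.isClosed_range

/-- The origin lies in the kernel set. [folklore] -/
theorem origin_mem_kerSet : origin X ∈ kerSet g := toSchemeHom_origin g

/-- The origin is a closed point. [folklore] -/
theorem isClosed_singleton_origin (A : AbelianVariety K) : IsClosed ({origin A} : Set A.X.left) := by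
  rw [← range_unitPt]; exact (unitPt A).isClosedEmbedding.isClosed_range

/-- **The kernel of a surjection `X ↠ Y` with `dim Y < dim X` is positive-dimensional**: it
contains two distinct points, one specialising to the other (dimension formula
`dim X = dim Y + dim Ker g`, `dim_eq_dim_add_topologicalKrullDim_ker`). [folklore] -/
theorem exists_specializes_ne_of_dim_lt [Surjective (Hom.toSchemeHom g)] (h : Y.dim < X.dim) :
    ∃ x₁ x₀ : X.X.left, x₁ ∈ kerSet g ∧ x₀ ∈ kerSet g ∧ x₁ ⤳ x₀ ∧ x₁ ≠ x₀ := by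
  haveI : IsClosedImmersion (Hom.kerι g) := MorphismProperty.pullback_fst _ _ inferInstance
  have hd := dim_eq_dim_add_topologicalKrullDim_ker g
  -- `1 ≤ dim Ker g`
  have h1 : (1 : WithBot ℕ∞) ≤ topologicalKrullDim ↥(Hom.ker g) := by
    induction hdk : topologicalKrullDim ↥(Hom.ker g) using WithBot.recBotCoe with
    | bot =>
      exfalso
      rw [hdk, WithBot.add_bot] at hd
      exact WithBot.coe_ne_bot hd
    | coe d =>
      rw [hdk] at hd
      have hd' : ((X.dim : ℕ∞) : WithBot ℕ∞) = ((Y.dim + d : ℕ∞) : WithBot ℕ∞) := by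
        rw [hd]; rfl
      have hd'' : (X.dim : ℕ∞) = Y.dim + d := by exact_mod_cast hd'
      have hd0 : d ≠ 0 := by
        rintro rfl
        rw [add_zero] at hd''
        have : X.dim = Y.dim := by exact_mod_cast hd''
        omega
      exact_mod_cast (Order.one_le_iff_ne_zero.2 hd0 : (1 : ℕ∞) ≤ d)
  letI : PartialOrder ↥(Hom.ker g) := specializationOrder _
  rw [Literature.Topology.topologicalKrullDim_eq_krullDim, Order.one_le_krullDim_iff] at h1
  obtain ⟨a, b, hab⟩ := h1
  have hba : b ⤳ a := hab.le
  refine ⟨Hom.kerι g b, Hom.kerι g a, ?_, ?_, hba.map (Hom.kerι g).continuous, fun e => ?_⟩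
  · rw [kerSet_eq_range_kerι]; exact ⟨b, rfl⟩
  · rw [kerSet_eq_range_kerι]; exact ⟨a, rfl⟩
  · exact hab.ne ((Hom.kerι g).isClosedEmbedding.injective e).symm

/-- A `K`-point of `X` lying in the kernel set is killed by `g` (uniqueness of `K`-points at the
origin, `eq_of_base_eq_origin`). [folklore] -/
theorem comp_eq_one_of_apply_mem (P : X.Points K)
    (hP : P.left (IsLocalRing.closedPoint K) ∈ kerSet g) : P ≫ g.hom.hom.hom = 1 := by
  apply eq_of_base_eq_origin (A := Y)
  · change (P.left ≫ Hom.toSchemeHom g) (IsLocalRing.closedPoint K) = origin Y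
    rw [Scheme.Hom.comp_apply]
    exact hP
  · rw [one_left]
    change (unitPt Y) ((specOver K K).hom (IsLocalRing.closedPoint K)) = origin Y
    rw [eq_specPt K ((specOver K K).hom (IsLocalRing.closedPoint K))]

/-- Translations by points of the kernel do not change `g`: `t_Q ≫ g = g` for `g(Q) = e`.
[folklore] -/
theorem translation_comp_eq_self (Q : X.Points K) (hQ : Q ≫ g.hom.hom.hom = 1) :
    X.translation Q ≫ g.hom.hom.hom = g.hom.hom.hom := by
  unfold translation
  rw [MonObj.mul_comp, Category.assoc, hQ, MonObj.comp_one, one_mul, Category.id_comp]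

/-- For a closed subset `C` of the kernel set, `g` kills the reduced subscheme `X_C`:
`(X_C ↪ X) ≫ g = 1` (the composite factors through the reduced point `e : Spec K ↪ Y`).
[folklore] -/
theorem redSubι_comp_eq_one (C : Closeds X.X.left) (hCN : (C : Set X.X.left) ⊆ kerSet g) :
    redSubι C ≫ g.hom.hom.hom = 1 := by
  haveI : IsReduced (vanishingIdeal C).subscheme := isReduced_redSubOver_left C
  have hk : (unitPt Y).ker ≤ ((vanishingIdeal C).subschemeι ≫ Hom.toSchemeHom g).ker :=
    Scheme.Hom.ker_le_ker_of_range_subset_closure _ _ (by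
      rw [range_unitPt, (isClosed_singleton_origin Y).closure_eq]
      rintro _ ⟨b, rfl⟩
      rw [Scheme.Hom.comp_apply]
      exact hCN (by rw [← range_subschemeι_vanishingIdeal_eq C]; exact ⟨b, rfl⟩))
  set u := IsClosedImmersion.lift (unitPt Y) ((vanishingIdeal C).subschemeι ≫ Hom.toSchemeHom g) hk
    with hu
  have hfac : u ≫ unitPt Y = (vanishingIdeal C).subschemeι ≫ Hom.toSchemeHom g :=
    IsClosedImmersion.lift_fac _ _ _
  have hu' : u = (vanishingIdeal C).subschemeι ≫ X.X.hom := by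
    have h2 := congrArg (· ≫ Y.X.hom) hfac
    simp only [Category.assoc, unitPt_comp_hom, Category.comp_id, toSchemeHom_comp_hom] at h2
    exact h2
  apply Over.OverMorphism.ext
  rw [Over.comp_left, one_left]
  change (vanishingIdeal C).subschemeι ≫ Hom.toSchemeHom g = ((vanishingIdeal C).subschemeι ≫ X.X.hom) ≫ unitPt Y
  rw [← hu', hfac]

/-- **Stability of a maximal irreducible subset of the kernel through the origin.** If `C ∋ e` is a
closed irreducible subset of `g⁻¹(e)`, maximal among the irreducible subsets of `g⁻¹(e)`, then the
difference morphism maps `X_C × X_C` into `C`: its image is irreducible (`X_C × X_C` is integral,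
`K` being algebraically closed), lies in `g⁻¹(e)` (`g` is a homomorphism killing `X_C`) and
contains `C = δ(C × e)`. [folklore] -/
theorem range_divMor_subset_of_maximal [IsAlgClosed K] (C : Closeds X.X.left) (hC : IsIrreducible (C : Set X.X.left))
    (h1 : origin X ∈ C) (hCN : (C : Set X.X.left) ⊆ kerSet g)
    (hmax : ∀ Z : Set X.X.left, IsPreirreducible Z → (C : Set X.X.left) ⊆ Z → Z ⊆ kerSet g → Z = C) :
    Set.range ((redSubι C ⊗ₘ redSubι C) ≫ divMor X).left ⊆ C := by
  haveI := geometricallyIntegral_redSubOver_hom C hC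
  haveI : IsIntegral (redSubOver C ⊗ redSubOver C).left := SchemeOver.isIntegral_left _
  set m := (redSubι C ⊗ₘ redSubι C) ≫ divMor X with hm
  -- `g` kills `m`
  have hι1 : redSubι C ≫ g.hom.hom.hom = 1 := redSubι_comp_eq_one g C hCN
  have hm1 : m ≫ g.hom.hom.hom = 1 := by
    rw [hm, Category.assoc]
    unfold divMor
    rw [MonObj.mul_comp, GrpObj.inv_comp, MonObj.comp_mul, GrpObj.comp_inv, ← Category.assoc,
      ← Category.assoc, CartesianMonoidalCategory.tensorHom_fst, CartesianMonoidalCategory.tensorHom_snd,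
      Category.assoc, Category.assoc, hι1, MonObj.comp_one, MonObj.comp_one, inv_one, mul_one]
  have hmN : Set.range m.left ⊆ kerSet g := by
    rintro _ ⟨w, rfl⟩
    rw [mem_kerSet_iff, ← Scheme.Hom.comp_apply]
    have e : m.left ≫ Hom.toSchemeHom g = (1 : _ ⟶ Y.X).left := congrArg CommaMorphism.left hm1
    rw [e]
    exact range_one_left_subset Y _ ⟨w, rfl⟩
  -- `C ⊆ range m` via the section `b ↦ (b, e)`
  have hCm : (C : Set X.X.left) ⊆ Set.range m.left := by
    intro x hx
    rw [← range_redSubι_left C] at hx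
    obtain ⟨b, rfl⟩ := hx
    let s : redSubOver C ⟶ redSubOver C ⊗ redSubOver C :=
      CartesianMonoidalCategory.lift (𝟙 _) (CartesianMonoidalCategory.toUnit _ ≫ redSubOne C h1)
    have hs : s ≫ m = redSubι C := by
      rw [hm]
      unfold divMor
      rw [CartesianMonoidalCategory.lift_map_assoc, Category.id_comp, Category.assoc, redSubOne_ι,
        MonObj.comp_mul, GrpObj.comp_inv, CartesianMonoidalCategory.lift_fst,
        CartesianMonoidalCategory.lift_snd, ← Hom.one_def, inv_one, mul_one]
    refine ⟨s.left b, ?_⟩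
    rw [← Scheme.Hom.comp_apply]
    have e : s.left ≫ m.left = (redSubι C).left := congrArg CommaMorphism.left hs
    rw [e]
  -- the closure of the image is irreducible, inside the kernel set, and contains `C`
  have hZirr : IsPreirreducible (closure (Set.range m.left)) := by
    refine IsPreirreducible.closure ?_
    rw [← Set.image_univ]
    exact ((IrreducibleSpace.isIrreducible_univ _).image _ m.left.continuous.continuousOn).isPreirreducible
  have hZ : closure (Set.range m.left) = C :=
    hmax _ hZirr (hCm.trans subset_closure) (closure_minimal hmN (isClosed_kerSet g))
  exact subset_closure.trans hZ.le

/-- **An irreducible component of the kernel through the origin.** For a surjective homomorphism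
`g : X ↠ Y` with `0 < dim Y < dim X` over an algebraically closed field there is a closed
irreducible subset `C ∋ e` of `g⁻¹(e)`, maximal among the irreducible subsets of `g⁻¹(e)`, with at
least two points and `C ≠ X`: translate a positive-dimensional irreducible subset of the kernel by
one of its closed (= rational) points and take a maximal irreducible subset of `g⁻¹(e)` containing
the translate. [folklore] -/
theorem exists_maximal_irreducible_kerSet [IsAlgClosed K] [Surjective (Hom.toSchemeHom g)] (h0 : 0 < Y.dim)
    (h : Y.dim < X.dim) :
    ∃ C : Closeds X.X.left, IsIrreducible (C : Set X.X.left) ∧ origin X ∈ C ∧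
      (C : Set X.X.left) ⊆ kerSet g ∧
      (∀ Z : Set X.X.left, IsPreirreducible Z → (C : Set X.X.left) ⊆ Z → Z ⊆ kerSet g → Z = C) ∧
      (C : Set X.X.left).Nontrivial ∧ (C : Set X.X.left) ≠ Set.univ := by
  obtain ⟨x₁, x₀, hx₁, hx₀, hsp, hne⟩ := exists_specializes_ne_of_dim_lt g h
  -- `C' = closure {x₁}` and a closed point `c ∈ C'`
  have hC'N : closure {x₁} ⊆ kerSet g :=
    closure_minimal (Set.singleton_subset_iff.2 hx₁) (isClosed_kerSet g)
  have hx₀C' : x₀ ∈ closure ({x₁} : Set X.X.left) := hsp.mem_closure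
  have hx₁C' : x₁ ∈ closure ({x₁} : Set X.X.left) := subset_closure rfl
  obtain ⟨c, hcC', hc⟩ := (isClosed_closure (s := ({x₁} : Set X.X.left))).exists_closed_singleton
    ⟨x₁, hx₁C'⟩
  let P : X.Points K := X.pointOfClosed c hc
  have hPc : P.left (IsLocalRing.closedPoint K) = c := X.pt_pointOfClosed c hc
  have hP1 : P ≫ g.hom.hom.hom = 1 :=
    comp_eq_one_of_apply_mem g P (by rw [hPc]; exact hC'N hcC')
  have hQ1 : P⁻¹ ≫ g.hom.hom.hom = 1 := by rw [GrpObj.inv_comp, hP1, inv_one]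
  -- translate by `P⁻¹`
  set t := X.translation P⁻¹ with ht
  have htg : t.left ≫ Hom.toSchemeHom g = Hom.toSchemeHom g :=
    congrArg CommaMorphism.left (translation_comp_eq_self g P⁻¹ hQ1)
  have htN : ∀ x ∈ kerSet g, t.left x ∈ kerSet g := fun x hx => by
    rw [mem_kerSet_iff, ← Scheme.Hom.comp_apply, htg]; exact hx
  have htc : t.left c = origin X := by
    have e : (P ≫ t).left = (1 : specOver K K ⟶ X.X).left := by
      rw [ht, comp_translation, inv_mul_cancel]
    rw [← hPc, ← Scheme.Hom.comp_apply]
    change (P ≫ t).left (IsLocalRing.closedPoint K) = origin X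
    rw [e, one_left]
    change (unitPt X) ((specOver K K).hom (IsLocalRing.closedPoint K)) = origin X
    rw [eq_specPt K ((specOver K K).hom (IsLocalRing.closedPoint K))]
  have htinj : Function.Injective t.left := t.left.isOpenEmbedding.injective
  -- `D = t(C')`
  set D : Set X.X.left := t.left '' closure {x₁} with hD
  have hDirr : IsPreirreducible D :=
    (isIrreducible_singleton.closure.image _ t.left.continuous.continuousOn).isPreirreducible
  have hDN : D ⊆ kerSet g := by rintro _ ⟨x, hx, rfl⟩; exact htN x (hC'N hx)
  have hoD : origin X ∈ D := ⟨c, hcC', htc⟩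
  -- a maximal irreducible subset `C ⊇ D` of the kernel set
  obtain ⟨C, hCirr, hDC, hCN, hmax⟩ := exists_maximal_isPreirreducible_subset hDirr hDN
  have hCcl : IsClosed C := by
    rw [← closure_eq_iff_isClosed]
    exact hmax _ hCirr.closure subset_closure (closure_minimal hCN (isClosed_kerSet g))
  refine ⟨⟨C, hCcl⟩, ⟨⟨origin X, hDC hoD⟩, hCirr⟩, hDC hoD, hCN, hmax,
    ⟨t.left x₁, hDC ⟨x₁, hx₁C', rfl⟩, t.left x₀, hDC ⟨x₀, hx₀C', rfl⟩, fun e => hne (htinj e)⟩,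
    fun hCuniv => ?_⟩
  -- `C = X` would force `g⁻¹(e) = X`, i.e. `Y = {e}`, i.e. `dim Y = 0`
  have hNuniv : kerSet g = Set.univ := Set.eq_univ_of_univ_subset (hCuniv ▸ hCN)
  haveI : Subsingleton Y.X.left := ⟨fun y y' => by
    obtain ⟨x, rfl⟩ := (Hom.toSchemeHom g).surjective y
    obtain ⟨x', rfl⟩ := (Hom.toSchemeHom g).surjective y'
    have hx : x ∈ kerSet g := hNuniv ▸ Set.mem_univ x
    have hx' : x' ∈ kerSet g := hNuniv ▸ Set.mem_univ x'
    rw [mem_kerSet_iff] at hx hx'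
    rw [hx, hx']⟩
  have hdim : topologicalKrullDim Y.X.left ≤ 0 := by
    letI : PartialOrder Y.X.left := specializationOrder _
    rw [Literature.Topology.topologicalKrullDim_eq_krullDim]
    exact Order.krullDim_nonpos_of_subsingleton
  rw [topologicalKrullDim_left] at hdim
  have : Y.dim ≤ 0 := by exact_mod_cast hdim
  omega

/-- **A surjective homomorphism `X ↠ Y` with `0 < dim Y < dim X` has a non-simple source**: the
abelian subvariety on a maximal irreducible subset of the kernel through the origin has dimension
strictly between `0` and `dim X` (Mumford, *Abelian Varieties*, §19, proof of Cor. 2 of Thm. 1 — the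
identity component of the kernel; Milne 1986, §12). [folklore] -/
theorem not_isSimple_of_surjective_of_dim_lt [IsAlgClosed K] [Surjective (Hom.toSchemeHom g)] (h0 : 0 < Y.dim)
    (h : Y.dim < X.dim) : ¬ IsSimple X := by
  intro hX
  obtain ⟨C, hCirr, h1, hCN, hmax, h2, hCX⟩ := exists_maximal_irreducible_kerSet g h0 h
  have hδ := range_divMor_subset_of_maximal g C hCirr h1 hCN hmax
  exact hX (redSub C hCirr h1 hδ) (redSubHom C hCirr h1 hδ) inferInstance
    (dim_redSub_pos C hCirr h1 hδ h2) (dim_redSub_lt C hCirr h1 hδ hCX)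

end KernelComponent

/-! ### Mumford §19, Cor. 2 of Thm. 1 over an algebraically closed field -/

/-- **A non-zero homomorphism between simple abelian varieties over an algebraically closed field is
an isogeny** (Mumford, *Abelian Varieties*, §19, Cor. 2 of Thm. 1; Milne 1986, §12): `f` is
surjective (`surjective_of_isSimple`: its image is a non-zero abelian subvariety of the simple `Y`),
so `dim Y ≤ dim X`; `dim Y < dim X` is excluded by `not_isSimple_of_surjective_of_dim_lt` (the
identity component of the kernel would be a non-trivial abelian subvariety of the simple `X`), and a
surjection between abelian varieties of the same dimension is an isogeny
(`isIsogeny_of_isSimple_of_ne_zero_of_dim_eq`). [cite: MumfordAV1970, §19 Cor. 2 of Thm. 1 (p. 174)] -/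
theorem isIsogeny_of_isSimple_of_ne_zero [IsAlgClosed K] {X Y : AbelianVariety K} (hX : IsSimple X)
    (hY : IsSimple Y) (f : X ⟶ Y) (hf : f ≠ 0) : IsIsogeny f := by
  haveI := surjective_of_isSimple f hY hf
  rcases (dim_le_of_isSimple_of_ne_zero f hY hf).lt_or_eq with hlt | heq
  · exfalso
    have h0 : 0 < Y.dim :=
      Nat.pos_of_ne_zero fun h0 => hf (hom_eq_zero_of_dim_eq_zero (Or.inr h0) f)
    exact not_isSimple_of_surjective_of_dim_lt f h0 hlt hX
  · exact isIsogeny_of_isSimple_of_ne_zero_of_dim_eq f hY hf heq.symm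

/-- The hypothesis `hsimple` of `AbelianVariety.module_finite_hom_of_theoremOfCube_of_algebraicClosure`
and of `Motives/AbelianVarietyEndAlgebraSemisimpleProofs`, over any algebraically closed field (in
particular over `AlgebraicClosure K`). [cite: MumfordAV1970, §19 Cor. 2 of Thm. 1 (p. 174)] -/
theorem hsimple_of_isAlgClosed (L : Type u) [Field L] [IsAlgClosed L] :
    ∀ (X Y : AbelianVariety L), IsSimple X → IsSimple Y → ∀ f : X ⟶ Y, f ≠ 0 → IsIsogeny f :=
  fun _ _ hX hY f hf => isIsogeny_of_isSimple_of_ne_zero hX hY f hf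

end AbelianVariety

end Literature.AlgebraicGeometry.Motives
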